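import Mathlib
import HarnessLib
import Literature.MathematicalPhysics.StatisticalMechanics.StepOperatorBLipschitzUnifTorusFRD
import Literature.MathematicalPhysics.StatisticalMechanics.FluctuationKernelComparisonMidConnTorusFRD

/-!
# The FIRST-ORDER part of the `ℓ = 2` slot of `B_k` in the tuning parameter, volume-uniform:
# `‖B_{C̄}K − B_{𝒞_{1+q+h}}K‖_{k+1,0} ≤ L^d C_{8.7} C ((r₀+1)8q_H (3^{d+1}(2(c₁+1))^d)^{1/2} ½(Σ|h|)²K⁽²⁾) (2^dκ) A⁻¹`,
# `C̄ = ½(𝒞_{1+q} + 𝒞_{1+q+2h})` (step data `abkmStepData L R k` of the midpoint kernel FAMILY)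

Twin of `hamNorm_opB_sub_unif_of_torusFRD` (the `ℓ = 1` slot F4b) for the midpoint pair of the `ℓ = 2`
comparison: the pair property on connected polymers is `tayNormLE_fluct_mid_sub_fluct_conn_of_torusFRD`, the
`StepKernelBounds` of the midpoint kernel come from `stepKernelBounds_const_mul_convex3_of_torusFRD`.
Since `B_k` is linear in the fluctuation measure, the full `ℓ = 2` slot (F4b2) is this bound plus the genuine
second-order part `B_{C₂} − 2B_{C̄} + B_{C₀}` (not in this file) and `norm_secondDiff_le_bilinear`.

* **`hamNorm_opB_mid_sub_unif_of_torusFRD`**.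

## References
* S. Adams, S. Buchholz, R. Kotecký, S. Müller, arXiv:1910.13564, Lemma 8.7, Lemma 12.6 (12.52)
  [AdamsBuchholzKoteckyMuller2019].
* S. Buchholz, J. Funct. Anal. 275 (2018), Thm 4.5 [Buchholz2016].
-/

noncomputable section

namespace Literature.MathematicalPhysics.StatisticalMechanics.GradientRG

open scoped BigOperators
open Real Set Finset MeasureTheory
open Literature.MathematicalPhysics.StatisticalMechanics.GradientFRD
  (fourierCoeff cExt cExt_of_mem IsElliptic IsUnitSymm InShell iterDiff supNorm conv ellOp isElliptic_one)
open Literature.MathematicalPhysics.StatisticalMechanics.TorusPolymer (IsPolymer numBlocks blockOf boxCorner)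
open Literature.Barriers.CriticalPhenomena.LongRangePhi4.Polymer (IsConn)
open Literature.MathematicalPhysics.QuantumFieldTheory

variable {d M : ℕ} [NeZero M]

section Package

variable {L N Mord R n ñ : ℕ} {θbar lam μ δ₁ δ₀ A𝒫 : ℝ}
    {𝒞 : Matrix (Fin d) (Fin d) ℝ → ℕ → (Fin d → ZMod M) → ℝ} {Mc : ℕ → ℝ}
    {Cα : (Fin d → ℕ) → ℕ → ℝ} {c C : ℝ} {Cℓ : ℕ → ℝ}

set_option maxHeartbeats 3200000 in
/-- **`‖B_{C̄}K − B_{𝒞_{1+q+h}}K‖_{k+1,0} ≤ L^d · C_{8.7} · C ℓ⁽²⁾ (2^dκ) A⁻¹` with the `N`-FREE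
`ℓ⁽²⁾ = (r₀+1) 8q_H (3^{d+1}(2(c₁+1))^d)^{1/2} · ½(Σ|h|)² K⁽²⁾`** (`c₁ = 2(2^d+R) + 2p_Φ + 1`), for symmetric
`q`, `h` with `q, q+h, q+2h` in the ball `Σ|·| ≤ T₀ ≤ ½`, `k + 1 ≤ N`; `C̄ = ½(𝒞_{1+q} + 𝒞_{1+q+2h})` as a
kernel family. [cite: AdamsBuchholzKoteckyMuller2019, Lemma 8.7 / Lemma 12.6 (12.52)] -/
theorem hamNorm_opB_mid_sub_unif_of_torusFRD
    (hd : 3 ≤ d) (hMord : 1 ≤ Mord) (hMR : Mord ≤ R) (hLodd : Odd L) (hL : 2 ^ (d + 3) + 16 * R ≤ L)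
    (hM : M = L ^ N)
    (hθbar : 0 < θbar) (hlam : 0 < lam) (hn : 2 * Mord ≤ n) (hn2 : 2 ≤ n) (hnñ : n ≤ ñ)
    (hgap : d + 1 ≤ 2 * (ñ - n))
    (hc : 0 < c) (hC1 : 0 ≤ Cℓ 1) (hC2 : 0 ≤ Cℓ 2)
    (hallA : ∀ A : Matrix (Fin d) (Fin d) ℝ, IsElliptic (1 / 2 : ℝ) 2 A →
        (∀ k, 1 ≤ k → k ≤ N + 1 →
          ∑ x : Fin d → ZMod M, 𝒞 A k x = 0 ∧ ∀ x, 𝒞 A k (-x) = 𝒞 A k x) ∧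
        (∀ k, 1 ≤ k → k ≤ N + 1 → ∀ φ : (Fin d → ZMod M) → ℝ, ∑ x, φ x = 0 →
          0 ≤ ∑ x, ∑ y, φ x * 𝒞 A k (x - y) * φ y) ∧
        (∀ φ : (Fin d → ZMod M) → ℝ, ∑ x, φ x = 0 →
          ellOp A (conv (fun x => ∑ k ∈ Finset.Icc 1 (N + 1), 𝒞 A k x) φ) = φ) ∧
        (∀ k, 1 ≤ k → k ≤ N → Mc k ≤ 0 ∧
          ∀ x : Fin d → ZMod M, ((L : ℝ) ^ k) / 2 ≤ (supNorm x : ℝ) →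
            𝒞 A k x = Mc k) ∧
        (∀ k, 1 ≤ k → k ≤ N + 1 → ∀ B : Matrix (Fin d) (Fin d) ℝ, IsUnitSymm B →
          (∃ ε : ℝ, 0 < ε ∧ ∀ x : Fin d → ZMod M,
            ContDiffOn ℝ ⊤ (fun s : ℝ => 𝒞 (A + s • B) k x) (Set.Ioo (-ε) ε)) ∧
          ∀ α : Fin d → ℕ, ∑ i, α i ≤ n → ∀ ℓ : ℕ, ∀ x : Fin d → ZMod M,
            abs (iteratedDeriv ℓ (fun s : ℝ => iterDiff α (𝒞 (A + s • B) k) x) 0)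
              ≤ Cα α ℓ / (L : ℝ) ^ ((k - 1) * (d - 2 + ∑ i, α i))) ∧
        (∀ k, 1 ≤ k → k ≤ N + 1 → ∀ j : ℕ, ∀ κ : Fin d → ZMod M, κ ≠ 0 → InShell L j κ →
          (j < k →
            c / (L : ℝ) ^ (2 * (d + ñ) + 1) * (L : ℝ) ^ (2 * j)
                / (L : ℝ) ^ ((k - j) * (d - 1 + n)) ≤ (fourierCoeff (𝒞 A k) κ).re ∧
            ‖fourierCoeff (𝒞 A k) κ‖
              ≤ C * (L : ℝ) ^ (2 * (d + ñ) + 1) * (L : ℝ) ^ (2 * j)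
                  / (L : ℝ) ^ ((k - j) * (d - 1 + n))) ∧
          (k ≤ j →
            c / (L : ℝ) ^ (2 * (d + ñ) + 1) * (L : ℝ) ^ (2 * k)
                ≤ (fourierCoeff (𝒞 A k) κ).re ∧
            ‖fourierCoeff (𝒞 A k) κ‖ ≤ C * (L : ℝ) ^ (2 * k)) ∧
          ∀ B : Matrix (Fin d) (Fin d) ℝ, IsUnitSymm B → ∀ ℓ : ℕ, 1 ≤ ℓ →
            (j < k →
              ‖iteratedDeriv ℓ (fun s : ℝ => fourierCoeff (𝒞 (A + s • B) k) κ) 0‖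
                ≤ Cℓ ℓ * (L : ℝ) ^ (2 * (d + ñ) + 1) * (L : ℝ) ^ (2 * j)
                    / (L : ℝ) ^ ((k - j) * (d - 1 + ñ))) ∧
            (k ≤ j →
              ‖iteratedDeriv ℓ (fun s : ℝ => fourierCoeff (𝒞 (A + s • B) k) κ) 0‖
                ≤ Cℓ ℓ * (L : ℝ) ^ (2 * k))))
    (hB : AbkmWeightBounds L N Mord R n θbar lam μ δ₁ δ₀ A𝒫 (fun j => 𝒞 1 j)
      (abkmWeightData L N Mord R θbar (schedDelta δ₀ δ₁ N) fun j => 𝒞 1 j))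
    {k : ℕ} (hkN : k + 1 ≤ N) {pT r₀ : ℕ} (hpM : pT + d ≤ Mord) (hr₀ : 3 ≤ r₀) {h A : ℝ} (hh : 0 < h)
    (hA : 1 ≤ A) {ρ : ℝ} (hρ0 : 0 ≤ ρ) (hρ : ρ < θbar)
    {T₀ : ℝ} (hT₀ : T₀ ≤ 1 / 2) (hKT₀ : shellRatioConst c (Cℓ 1) (L : ℝ) d ñ * T₀ ≤ Real.log (1 + ρ))
    {q y : Matrix (Fin d) (Fin d) ℝ} (hq : q.IsSymm) (hh' : y.IsSymm)
    (hqT : ∑ i, ∑ j, |q i j| ≤ T₀) (hqhT : ∑ i, ∑ j, |(q + y) i j| ≤ T₀)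
    (hq2hT : ∑ i, ∑ j, |(q + (2 : ℝ) • y) i j| ≤ T₀)
    {p qH ρ'' : ℝ} (hpq : p.HolderConjugate qH) (hρ''0 : 0 ≤ ρ'') (hρ'' : ρ'' < θbar)
    (hpρ : p * (1 + ρ) ≤ 1 + ρ'')
    {K : Finset (Fin d → ZMod M) → ((Fin d → ZMod M) → ℝ) → ℂ} {C : ℝ} (hC : 0 ≤ C)
    (hK : WeakNormLE (abkmNormParams L N Mord R pT r₀ h θbar A (schedDelta δ₀ δ₁ N) fun j => 𝒞 1 j) k K C)
    (hKd : ∀ X, ContDiff ℝ r₀ (K X))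
    (hKloc : ∀ X, IsPolymer (L ^ k) X → IsConn X →
      IsGaugeLocal ((abkmNormParams L N Mord R pT r₀ h θbar A (schedDelta δ₀ δ₁ N) fun j => 𝒞 1 j).gauge k X)
        (K X)) :
    hamNorm (fieldWt h L d (k + 1)) ((L : ℝ) ^ (k + 1)) (L ^ (d * (k + 1)))
        (opB (abkmStepData L R k fun j x => 2⁻¹ * 𝒞 ((1 : Matrix (Fin d) (Fin d) ℝ) + q) j x +
            2⁻¹ * 𝒞 ((1 : Matrix (Fin d) (Fin d) ℝ) + (q + (2 : ℝ) • y)) j x) K -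
          opB (abkmStepData L R k fun j => 𝒞 ((1 : Matrix (Fin d) (Fin d) ℝ) + (q + y)) j) K) ≤
      (L : ℝ) ^ d * (pi2BoundConst d (((2 * R + 2 : ℕ) : ℝ) + ((d / 2 + 1 : ℕ) : ℝ)) *
        (C * ((r₀ + 1) * (8 * qH *
            (Real.sqrt ((3 : ℝ) ^ (d + 1) * (((2 * ((2 * (2 ^ d + R) + 2 * pT + 1) + 1) : ℕ) : ℝ)) ^ d) *
              (2⁻¹ * (∑ i, ∑ j, |y i j|) ^ 2 * shellRatioConst c (Cℓ 2) (L : ℝ) d ñ)))) *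
          ((2 : ℝ) ^ d * weightIntConstRho θbar ρ'' (traceConst d Mord R lam (derivSum d n fun θ' _ => Cα θ' 0)) ^ (1 / p)) *
            A⁻¹)) := by
  set Da := abkmStepData L R k fun j x => 2⁻¹ * 𝒞 ((1 : Matrix (Fin d) (Fin d) ℝ) + q) j x +
    2⁻¹ * 𝒞 ((1 : Matrix (Fin d) (Fin d) ℝ) + (q + (2 : ℝ) • y)) j x with hDa
  set Db := abkmStepData L R k fun j => 𝒞 ((1 : Matrix (Fin d) (Fin d) ℝ) + (q + y)) j with hDb
  have hk : k + 1 ≤ N + 1 := by omega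
  have hqh : (q + y).IsSymm := hq.add hh'
  have hq2h : (q + (2 : ℝ) • y).IsSymm := hq.add (hh'.smul _)
  have h1ρ : (1 : ℝ) * (1 + ρ) ≤ 1 + ρ := by rw [one_mul]
  have hSa : StepKernelBounds (abkmWeightData L N Mord R θbar (schedDelta δ₀ δ₁ N) fun j => 𝒞 1 j) L k
      (weightIntConstRho θbar ρ (traceConst d Mord R lam (derivSum d n fun θ' _ => Cα θ' 0)))
      (secondDiffConst fun θ' => Cα θ' 0) Da.𝒞 := by
    have h1 := stepKernelBounds_const_mul_convex3_of_torusFRD hd hMord hMR hLodd hL hθbar hlam hn hn2 hnñ hc hC1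
      hallA hB hk hρ0 hT₀ hKT₀ hq hqh hq2h hqT hqhT hq2hT (p := 1) zero_le_one hρ0 hρ h1ρ
      (a := 2⁻¹) (b := 0) (c₃ := 2⁻¹) (by norm_num) le_rfl (by norm_num) (by norm_num)
    have e : (fun x => (1 : ℝ) * (2⁻¹ * 𝒞 ((1 : Matrix (Fin d) (Fin d) ℝ) + q) (k + 1) x +
        0 * 𝒞 ((1 : Matrix (Fin d) (Fin d) ℝ) + (q + y)) (k + 1) x +
        2⁻¹ * 𝒞 ((1 : Matrix (Fin d) (Fin d) ℝ) + (q + (2 : ℝ) • y)) (k + 1) x)) = Da.𝒞 := by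
      funext x; simp only [hDa, abkmStepData]; ring
    rw [e, one_mul] at h1
    exact h1
  have hSb : StepKernelBounds (abkmWeightData L N Mord R θbar (schedDelta δ₀ δ₁ N) fun j => 𝒞 1 j) L k _ _ Db.𝒞 :=
    stepKernelBounds_one_add_of_torusFRD hd hMord hMR hLodd hL hθbar hlam hn hn2 hnñ hc hC1 hallA hB hk
      hρ0 hρ hT₀ hKT₀ hqh hqhT
  have hA𝒫p : 0 ≤ weightIntConstRho θbar ρ'' (traceConst d Mord R lam (derivSum d n fun θ' _ => Cα θ' 0)) :=
    zero_le_one.trans (one_le_weightIntConstRho hθbar hρ''0 hρ''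
      (traceConst_nonneg d Mord R hlam.le (derivSum_nonneg d n _)))
  set κ := weightIntConstRho θbar ρ'' (traceConst d Mord R lam (derivSum d n fun θ' _ => Cα θ' 0)) ^ (1 / p) with hκdef
  have hκ0 : 0 ≤ κ := Real.rpow_nonneg hA𝒫p _
  set c₁ : ℕ := 2 * (2 ^ d + R) + 2 * pT + 1 with hc₁
  set EK := 2⁻¹ * (∑ i, ∑ j, |y i j|) ^ 2 * shellRatioConst c (Cℓ 2) (L : ℝ) d ñ with hEK
  have hK0' : 0 ≤ shellRatioConst c (Cℓ 2) (L : ℝ) d ñ := shellRatioConst_nonneg hc hC2 (Nat.cast_nonneg _) d ñ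
  have hT0 : 0 ≤ ∑ i, ∑ j, |y i j| := sum_nonneg fun _ _ => sum_nonneg fun _ _ => abs_nonneg _
  have hEK0 : 0 ≤ EK := by positivity
  -- the pair property on connected polymers, polynomial factor absorbed into `κ' = 2^d κ`
  refine hamNorm_opB_sub_abkm_le_of_stepKernelBounds hd hLodd hL hM hkN hpM hMR hr₀ hB hh hA Da Db hSa hSb
    (x₀ := 0) rfl rfl rfl rfl
    (ℓ := (r₀ + 1) * (8 * qH * (Real.sqrt ((3 : ℝ) ^ (d + 1) * (((2 * (c₁ + 1) : ℕ) : ℝ)) ^ d) * EK)))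
    (κ := (2 : ℝ) ^ d * κ) (fun X hX hXc F C0 hC0 hFd hFloc hF => ?_) hC hK hKd hKloc
  have hconn := tayNormLE_fluct_mid_sub_fluct_conn_of_torusFRD hd hMord hMR hLodd hL hM hθbar hlam hn hn2 hnñ hgap hc
    hC1 hC2 hallA hB hkN hρ0 hρ hT₀ hKT₀ hq hh' hqT hqhT hq2hT hpq hρ''0 hρ'' hpρ hX hXc hC0 hFd hFloc hF
    (pT := pT) (r₀ := r₀) (h := h) (A := A)
  refine hconn.mono ?_ (fun φ => ((abkmWeightData L N Mord R θbar (schedDelta δ₀ δ₁ N) fun j => 𝒞 1 j).midWeight_pos k X φ).le)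
  set m := numBlocks (L ^ k) X with hm
  have hsq := sqrt_polymerFactor_le d m c₁
  have hmc : 2 * (m + 2 * (2 ^ d + R) + 2 * pT + 1) = 2 * (m + c₁) := by rw [hc₁]; ring
  rw [hmc]
  have hq1 : 0 ≤ qH := by linarith [hpq.symm.lt]
  calc C0 * ((r₀ + 1) * (8 * qH * (Real.sqrt ((3 : ℝ) ^ (d + 1) * (((2 * (m + c₁) : ℕ) : ℝ)) ^ d) * EK))) * κ ^ m
      ≤ C0 * ((r₀ + 1) * (8 * qH *
          (Real.sqrt ((3 : ℝ) ^ (d + 1) * (((2 * (c₁ + 1) : ℕ) : ℝ)) ^ d) * ((2 : ℝ) ^ d) ^ m * EK))) * κ ^ m := by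
        have : Real.sqrt ((3 : ℝ) ^ (d + 1) * (((2 * (m + c₁) : ℕ) : ℝ)) ^ d) * EK ≤
            Real.sqrt ((3 : ℝ) ^ (d + 1) * (((2 * (c₁ + 1) : ℕ) : ℝ)) ^ d) * ((2 : ℝ) ^ d) ^ m * EK :=
          mul_le_mul_of_nonneg_right hsq hEK0
        gcongr
    _ = C0 * ((r₀ + 1) * (8 * qH * (Real.sqrt ((3 : ℝ) ^ (d + 1) * (((2 * (c₁ + 1) : ℕ) : ℝ)) ^ d) * EK))) *
          ((2 : ℝ) ^ d * κ) ^ m := by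
        rw [mul_pow]; ring


end Package

end Literature.MathematicalPhysics.StatisticalMechanics.GradientRG

end
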